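import Literature.NumberTheory.EllipticCurves.HalfIntegralWeightForms

/-!
# Reducing `θ`-automorphy to generators

[[cite: Shimura1973HalfIntegral, §1]] — the automorphy factor `j(γ, z) = θ(γz)/θ(z)` of the theta
function is a cocycle on `Γ₀(4)`, so a transformation law of half-integral weight need only be checked
on a set of generators.  We phrase this for the tree's predicate `IsThetaAutomorphic` (which is stated
multiplicatively, `f(γz) θ(z)^k = χ(d) θ(γz)^k f(z)`, to avoid dividing by `θ`): the set of
`γ ∈ Γ₀(N)` satisfying the law for a *continuous* `f` is a subgroup.  Closure under products needs
`θ(γ₂ z) ≠ 0`, which holds on a dense set by the identity theorem; continuity carries the law to all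
of `ℍ`.  Used for the level-256 Shintani kernel (`Γ₀(256) = ⟨T, −1, (a b; 256 d)⟩`,
`Gamma0TwoPowerGenerators`).  No new facts.
-/

noncomputable section

open Complex UpperHalfPlane MatrixGroups CongruenceSubgroup ModularForm
open scoped Topology Manifold

namespace Literature.NumberTheory.EllipticCurves.ModularForms

variable {k N : ℕ} {χ : DirichletCharacter ℂ N} {f : ℍ → ℂ}

/-- The `θ`-multiplier transformation law of `IsThetaAutomorphic k N χ f` for a single matrix `γ`:
`f(γz) θ(z)^k = χ(d_γ) θ(γz)^k f(z)` for all `z`. [cite: Shimura1973HalfIntegral, §1] -/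
def ThetaLaw (k N : ℕ) (χ : DirichletCharacter ℂ N) (f : ℍ → ℂ) (γ : SL(2, ℤ)) : Prop :=
  ∀ z : ℍ, f (γ • z) * shimuraTheta z ^ k =
    χ ((γ 1 1 : ℤ) : ZMod N) * shimuraTheta (γ • z) ^ k * f z

/-- `IsThetaAutomorphic` is the conjunction of the laws over `Γ₀(N)`. [folklore] -/
theorem isThetaAutomorphic_iff :
    IsThetaAutomorphic k N χ f ↔ ∀ γ ∈ Gamma0 N, ThetaLaw k N χ f γ := Iff.rfl

/-! ## Continuity of the action and holomorphy of `z ↦ θ(γ z)` -/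

/-- The bottom row of a matrix in `SL(2, ℤ)` is nonzero. [folklore] -/
theorem sl_bottom_row_ne_zero (γ : SL(2, ℤ)) :
    (![((γ 1 0 : ℤ) : ℝ), ((γ 1 1 : ℤ) : ℝ)] : Fin 2 → ℝ) ≠ 0 := by
  intro h
  have h0 : ((γ 1 0 : ℤ) : ℝ) = 0 := by simpa using congr_fun h 0
  have h1 : ((γ 1 1 : ℤ) : ℝ) = 0 := by simpa using congr_fun h 1
  have hdet := Matrix.SpecialLinearGroup.det_coe γ
  rw [Matrix.det_fin_two] at hdet
  have : (γ 1 0 : ℤ) = 0 := by exact_mod_cast h0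
  have : (γ 1 1 : ℤ) = 0 := by exact_mod_cast h1
  simp_all

/-- `c z + d ≠ 0` for `(c, d)` the bottom row of `γ ∈ SL(2, ℤ)`. [folklore] -/
theorem sl_denom_ne_zero' (γ : SL(2, ℤ)) (z : ℍ) :
    (((γ 1 0 : ℤ) : ℝ) : ℂ) * z + (((γ 1 1 : ℤ) : ℝ) : ℂ) ≠ 0 := by
  have := UpperHalfPlane.linear_ne_zero z (sl_bottom_row_ne_zero γ)
  simpa using this

/-- The action of `γ ∈ SL(2, ℤ)` on `ℍ` is continuous. [folklore] -/
theorem continuous_sl_smul (γ : SL(2, ℤ)) : Continuous fun z : ℍ ↦ γ • z := by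
  rw [isOpenEmbedding_coe.isEmbedding.continuous_iff]
  have h : (UpperHalfPlane.coe ∘ fun z : ℍ ↦ γ • z) = fun z : ℍ ↦
      ((((γ 0 0 : ℤ) : ℝ) : ℂ) * z + (((γ 0 1 : ℤ) : ℝ) : ℂ)) /
        ((((γ 1 0 : ℤ) : ℝ) : ℂ) * z + (((γ 1 1 : ℤ) : ℝ) : ℂ)) := by
    funext z
    simp [specialLinearGroup_apply]
  rw [h]
  exact Continuous.div (by fun_prop) (by fun_prop) (sl_denom_ne_zero' γ)

/-- `z ↦ θ(γ z)` is holomorphic on `ℍ` (it is the weight-0 slash `θ ∣[0] γ`). [folklore] -/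
theorem mdifferentiable_shimuraTheta_smul (γ : SL(2, ℤ)) :
    MDifferentiable 𝓘(ℂ) 𝓘(ℂ) fun z : ℍ ↦ shimuraTheta (γ • z) := by
  have h : MDifferentiable 𝓘(ℂ) 𝓘(ℂ) (shimuraTheta ∣[(0 : ℤ)] γ) :=
    mdifferentiable_shimuraTheta.slash (0 : ℤ) γ
  have heq : (shimuraTheta ∣[(0 : ℤ)] γ) = fun z : ℍ ↦ shimuraTheta (γ • z) := by
    funext z
    rw [ModularForm.SL_slash_apply]
    simp
  rw [heq] at h
  exact h

/-- `z ↦ θ(γ z)` is continuous. [folklore] -/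
theorem continuous_shimuraTheta_smul (γ : SL(2, ℤ)) :
    Continuous fun z : ℍ ↦ shimuraTheta (γ • z) :=
  (mdifferentiable_shimuraTheta_smul γ).continuous

/-- Identity theorem: `θ(γ z) ≠ 0` on a dense subset of `ℍ`. [folklore] -/
theorem dense_shimuraTheta_smul_ne_zero (γ : SL(2, ℤ)) :
    Dense {z : ℍ | shimuraTheta (γ • z) ≠ 0} := by
  rw [dense_iff_inter_open]
  intro U hU hUne
  by_contra hcon
  rw [Set.not_nonempty_iff_eq_empty] at hcon
  -- `θ ∘ γ` vanishes on the nonempty open set `U`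
  have hvan : ∀ z ∈ U, shimuraTheta (γ • z) = 0 := by
    intro z hz
    by_contra hne
    have : z ∈ U ∩ {z : ℍ | shimuraTheta (γ • z) ≠ 0} := ⟨hz, hne⟩
    rw [hcon] at this
    exact this
  obtain ⟨z₀, hz₀⟩ := hUne
  -- transfer to `ℂ`
  set G : ℂ → ℂ := (fun z : ℍ ↦ shimuraTheta (γ • z)) ∘ ↑ofComplex with hG
  have hGd : DifferentiableOn ℂ G {w : ℂ | 0 < w.im} :=
    UpperHalfPlane.mdifferentiable_iff.mp (mdifferentiable_shimuraTheta_smul γ)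
  have hGa : AnalyticOnNhd ℂ G {w : ℂ | 0 < w.im} :=
    hGd.analyticOnNhd (isOpen_lt continuous_const Complex.continuous_im)
  have hpre : IsPreconnected {w : ℂ | 0 < w.im} := (convex_halfSpace_im_gt 0).isPreconnected
  have hz₀H : (z₀ : ℂ) ∈ {w : ℂ | 0 < w.im} := z₀.im_pos
  have hev : G =ᶠ[𝓝 (z₀ : ℂ)] 0 := by
    have hopen : IsOpen (UpperHalfPlane.coe '' U) := isOpenEmbedding_coe.isOpenMap U hU
    have hmem : (z₀ : ℂ) ∈ UpperHalfPlane.coe '' U := ⟨z₀, hz₀, rfl⟩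
    filter_upwards [hopen.mem_nhds hmem] with w hw
    obtain ⟨u, hu, rfl⟩ := hw
    simp only [hG, Function.comp_apply, ofComplex_apply, Pi.zero_apply]
    exact hvan u hu
  have hzero := hGa.eqOn_zero_of_preconnected_of_eventuallyEq_zero hpre hz₀H hev
  -- evaluate at `γ⁻¹ • I`
  have hI : shimuraTheta UpperHalfPlane.I = 0 := by
    have hmem : ((γ⁻¹ • UpperHalfPlane.I : ℍ) : ℂ) ∈ {w : ℂ | 0 < w.im} :=
      (γ⁻¹ • UpperHalfPlane.I).im_pos
    have := hzero hmem
    simp only [hG, Function.comp_apply, ofComplex_apply, Pi.zero_apply, smul_inv_smul] at this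
    exact this
  exact shimuraTheta_I_ne_zero hI

/-- A closed subset of `ℍ` containing the dense set `{θ(γ z) ≠ 0}` is everything. [folklore] -/
theorem eq_univ_of_dense_of_isClosed {E : Set ℍ} (γ : SL(2, ℤ)) (hE : IsClosed E)
    (hsub : {z : ℍ | shimuraTheta (γ • z) ≠ 0} ⊆ E) : E = Set.univ := by
  have hd : Dense E := (dense_shimuraTheta_smul_ne_zero γ).mono hsub
  rw [← hE.closure_eq]
  exact hd.closure_eq

/-! ## The laws form a subgroup -/

/-- The law for `1`. [folklore] -/
theorem thetaLaw_one : ThetaLaw k N χ f 1 := by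
  intro z
  simp [mul_comm]

/-- `d_{γ₁ γ₂} ≡ d_{γ₁} d_{γ₂} (mod N)` for `γ₁ ∈ Γ₀(N)`. [folklore] -/
theorem chi_mul_entry {γ₁ : SL(2, ℤ)} (h₁ : γ₁ ∈ Gamma0 N) (γ₂ : SL(2, ℤ)) :
    χ (((γ₁ * γ₂) 1 1 : ℤ) : ZMod N) =
      χ ((γ₁ 1 1 : ℤ) : ZMod N) * χ ((γ₂ 1 1 : ℤ) : ZMod N) := by
  rw [Gamma0_mem] at h₁
  rw [← map_mul]
  congr 1
  have : ((γ₁ * γ₂) 1 1 : ℤ) = γ₁ 1 0 * γ₂ 0 1 + γ₁ 1 1 * γ₂ 1 1 := by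
    simp [Matrix.mul_apply, Fin.sum_univ_two]
  rw [this]
  push_cast
  rw [h₁]
  ring

/-- `χ(a_γ) χ(d_γ) = 1` for `γ ∈ Γ₀(N)` (`ad = 1 + bc ≡ 1`). [folklore] -/
theorem chi_a_mul_chi_d {γ : SL(2, ℤ)} (h : γ ∈ Gamma0 N) :
    χ ((γ 0 0 : ℤ) : ZMod N) * χ ((γ 1 1 : ℤ) : ZMod N) = 1 := by
  rw [Gamma0_mem] at h
  rw [← map_mul]
  have hdet := Matrix.SpecialLinearGroup.det_coe γ
  rw [Matrix.det_fin_two] at hdet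
  have : ((γ 0 0 : ℤ) : ZMod N) * ((γ 1 1 : ℤ) : ZMod N) = 1 := by
    have h' : ((γ 0 0 * γ 1 1 - γ 0 1 * γ 1 0 : ℤ) : ZMod N) = 1 := by
      rw [hdet]; simp
    push_cast at h'
    rw [h] at h'
    linear_combination h'
  rw [this, map_one]

/-- The law is stable under inverses (within `Γ₀(N)`). [folklore] -/
theorem thetaLaw_inv {γ : SL(2, ℤ)} (hγ : γ ∈ Gamma0 N) (h : ThetaLaw k N χ f γ) :
    ThetaLaw k N χ f γ⁻¹ := by
  intro z
  have h1 := h (γ⁻¹ • z)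
  rw [smul_inv_smul] at h1
  have hinv : ((γ⁻¹ : SL(2, ℤ)) 1 1 : ℤ) = γ 0 0 := by
    rw [Matrix.SpecialLinearGroup.SL2_inv_expl]
    rfl
  rw [hinv]
  have hu := chi_a_mul_chi_d (χ := χ) hγ
  -- multiply `h1` by `χ(a)` and use `χ(a) χ(d) = 1`
  linear_combination (-(χ ((γ 0 0 : ℤ) : ZMod N))) * h1 -
    (shimuraTheta z ^ k * f (γ⁻¹ • z)) * hu

/-- The law is stable under products, for continuous `f` (density of `{θ(γ₂ z) ≠ 0}`).
[cite: Shimura1973HalfIntegral, §1] -/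
theorem thetaLaw_mul (hf : Continuous f) {γ₁ γ₂ : SL(2, ℤ)} (h₁ : γ₁ ∈ Gamma0 N)
    (hl₁ : ThetaLaw k N χ f γ₁) (hl₂ : ThetaLaw k N χ f γ₂) :
    ThetaLaw k N χ f (γ₁ * γ₂) := by
  -- the equality set is closed
  set E : Set ℍ := {z : ℍ | f ((γ₁ * γ₂) • z) * shimuraTheta z ^ k =
    χ (((γ₁ * γ₂) 1 1 : ℤ) : ZMod N) * shimuraTheta ((γ₁ * γ₂) • z) ^ k * f z} with hE
  have hclosed : IsClosed E := by
    apply isClosed_eq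
    · exact (hf.comp (continuous_sl_smul _)).mul (mdifferentiable_shimuraTheta.continuous.pow k)
    · exact (continuous_const.mul ((continuous_shimuraTheta_smul _).pow k)).mul hf
  -- it contains the dense set `{θ(γ₂ z) ≠ 0}`
  have hsub : {z : ℍ | shimuraTheta (γ₂ • z) ≠ 0} ⊆ E := by
    intro z hz
    rw [Set.mem_setOf_eq] at hz
    rw [hE, Set.mem_setOf_eq]
    have e1 := hl₁ (γ₂ • z)
    have e2 := hl₂ z
    rw [chi_mul_entry h₁, mul_smul]
    have hpow : shimuraTheta (γ₂ • z) ^ k ≠ 0 := pow_ne_zero _ hz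
    apply mul_right_cancel₀ hpow
    linear_combination (shimuraTheta z ^ k) * e1 +
      (χ ((γ₁ 1 1 : ℤ) : ZMod N) * shimuraTheta (γ₁ • γ₂ • z) ^ k) * e2
  have huniv := eq_univ_of_dense_of_isClosed γ₂ hclosed hsub
  intro z
  have hz : z ∈ E := by rw [huniv]; trivial
  rw [hE, Set.mem_setOf_eq] at hz
  exact hz

/-- The subgroup of `Γ₀(N)` on which a continuous `f` satisfies the `θ`-multiplier law.
[cite: Shimura1973HalfIntegral, §1] -/
def thetaLawSubgroup (k N : ℕ) (χ : DirichletCharacter ℂ N) (f : ℍ → ℂ) (hf : Continuous f) :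
    Subgroup SL(2, ℤ) where
  carrier := {γ | γ ∈ Gamma0 N ∧ ThetaLaw k N χ f γ}
  one_mem' := ⟨one_mem _, thetaLaw_one⟩
  mul_mem' := fun {_ _} ha hb ↦ ⟨mul_mem ha.1 hb.1, thetaLaw_mul hf ha.1 ha.2 hb.2⟩
  inv_mem' := fun {_} ha ↦ ⟨inv_mem ha.1, thetaLaw_inv ha.1 ha.2⟩

/-- Membership in `thetaLawSubgroup`. [folklore] -/
theorem mem_thetaLawSubgroup (hf : Continuous f) (γ : SL(2, ℤ)) :
    γ ∈ thetaLawSubgroup k N χ f hf ↔ γ ∈ Gamma0 N ∧ ThetaLaw k N χ f γ := Iff.rfl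

/-- **Automorphy from generators.** If a continuous `f` satisfies the `θ`-multiplier law of weight
`k/2`, level `N`, character `χ` for every element of a set `S ⊆ Γ₀(N)` generating a subgroup
containing `Γ₀(N)`, then `f` is `θ`-automorphic. [cite: Shimura1973HalfIntegral, §1] -/
theorem isThetaAutomorphic_of_generators (hf : Continuous f) (S : Set SL(2, ℤ))
    (hSN : S ⊆ (Gamma0 N : Set SL(2, ℤ)))
    (hgen : (Gamma0 N : Set SL(2, ℤ)) ⊆ Subgroup.closure S)
    (hlaw : ∀ γ ∈ S, ThetaLaw k N χ f γ) : IsThetaAutomorphic k N χ f := by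
  intro γ hγ
  have hle : Subgroup.closure S ≤ thetaLawSubgroup k N χ f hf := by
    rw [Subgroup.closure_le]
    intro σ hσ
    exact ⟨hSN hσ, hlaw σ hσ⟩
  exact (hle (hgen hγ)).2

end Literature.NumberTheory.EllipticCurves.ModularForms
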